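import Mathlib.GroupTheory.FreeGroup.NielsenSchreier
import Literature.GroupTheory.CombinatorialGroupTheory.PushoutITreeQuotientLoops
import HarnessLib

/-!
# `N ≅ π₁(N \ T)`: normal subgroups of `∗_H G_i` meeting the factors trivially are free
# (Bass–Serre quotient route)

Topic `Literature/GroupTheory/CombinatorialGroupTheory`; theorems only (no definitions), second proof
file over `PushoutITreeQuotient.lean` / `PushoutITreeQuotientLoops.lean` (the quotient `N \ T` of the
Bass–Serre tree of `P = Monoid.PushoutI φ` by a normal subgroup `N`, its labelling functor `F` to `P`,
(C1) loops ↦ `N`, (C2) injectivity on vertex groups).  Results (J.-P. Serre, *Trees* (1980), I §3.3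
Thm. 4 "a group acting freely on a tree is free, `≅ π₁` of the quotient graph", applied to the tree of
the amalgam I §4.1 Thm. 7; H. Neumann; Magnus–Karrass–Solitar Cor. 4.9.2):

* (C3) `exists_path` / `exists_loop_fval_eq`: explicit zigzags from `[1]` to every central vertex with
  controlled value (induction over the amalgam), so `F` maps `π₁(N \ T, [1])` ONTO `N`;
* (C4) `loopHom_injective`, `range_loopHom` (**`N` is the isomorphic image of `π₁(N \ T, [1])`**),
  `isFreeGroup_end` (vertex groups of free groupoids of quivers are free: faithful word functor,
  Stallings Prop. 5.2, + Nielsen–Schreier);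
* `PushoutI.isFreeGroup_of_normal_of_of_mem_eq_one`: if `φ i : H →* G i` are injective, `ι` is
  nonempty, and `N ⊴ ∗_H G_i` satisfies `N ∩ G_i = 1` for every `i`, then `N` is a free group
  (`…_of_conj_of_eq_one`: hypothesis in conjugation form); no finiteness assumed.

Relation to the tree: `AmalgamFreeSubgroups.isFreeGroup_of_disjoint_conjugates` (action-groupoid
route, arbitrary subgroups) and `pushoutI_exists_isFreeGroup_normal_finiteIndex`
(`FiniteAmalgamVirtuallyFree.lean`, finite amalgams are virtually free) are the decls of record for
freeness; the present file is the Bass–Serre QUOTIENT-GRAPH form, whose extra content is the explicit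
isomorphism `loopHom : π₁(N \ T, [1]) ≃ N` (Serre's identification of `N` with the fundamental group
of the quotient graph).  With `exists_normal_finiteIndex_inf_conj_eq_bot`
(`FiniteAmalgamPermutationalProduct.lean`) the conjugation form gives virtual freeness of finite
amalgams again in two lines (not restated here). [SerreTrees1980] [Stallings1983]
-/

namespace Literature.GroupTheory.CombinatorialGroupTheory

universe u v w

namespace PushoutITree

open Monoid Monoid.PushoutI Function CategoryTheory FreeGroupoidWords

variable {ι : Type u} {G : ι → Type v} [∀ i, Group (G i)] {H : Type w} [Group H]
  {φ : ∀ i, H →* G i} {N : Subgroup (PushoutI φ)}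

/-! ### (C3) Surjectivity onto `N`: a zigzag to every central vertex with controlled value -/

/-- The `H`-defect is constant on `N`. [cite: SerreTrees1980, I §3.3 Thm. 4] -/
theorem baseDefect_eq_of_mem [N.Normal] [Nonempty ι] (hφ : ∀ i, Injective (φ i))
    (hN : ∀ (i : ι) (g : G i), (of i g : PushoutI φ) ∈ N → g = 1) {p : PushoutI φ} (hp : p ∈ N) :
    baseDefect N p = baseDefect N 1 := by
  have h1 : (QuotientGroup.mk p : CenterClass N) = QuotientGroup.mk 1 := by
    rw [QuotientGroup.eq, mul_one]
    exact Subgroup.mem_sup_left (N.inv_mem hp)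
  have hsp := baseDefect_spec (N := N) p
  have hs1 := baseDefect_spec (N := N) (1 : PushoutI φ)
  unfold baseDefect at hsp ⊢
  rw [h1] at hsp ⊢
  rw [mul_one] at hs1
  refine eq_of_mul_inv_base_mem hφ hN ?_ hs1
  have := ‹N.Normal›.conj_mem _ (N.inv_mem hp)
    (PushoutI.base φ (basePart N (((QuotientGroup.mk (1 : PushoutI φ) : CenterClass N).out)⁻¹ * p)))
  convert N.mul_mem hsp this using 1
  group

/-- One step to the right: extend a zigzag ending at `[p]` through the arm vertex `[p G_i]` to
`[p · g]`, `g ∈ G_i`; the value picks up exactly `β(pg) g⁻¹ β(p)⁻¹` (`β` the `H`-defect).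
[cite: SerreTrees1980, I §3.3 Thm. 4] -/
theorem exists_path_step [N.Normal] (hN : ∀ (i : ι) (g : G i), (of i g : PushoutI φ) ∈ N → g = 1)
    (K : PushoutI φ) {p : PushoutI φ}
    (hp : ∃ γ : Quiver.Path (ctrS N (QuotientGroup.mk 1)) (ctrS N (QuotientGroup.mk p)),
      fval N (homMk γ) = PushoutI.base φ (baseDefect N p) * p⁻¹ * K)
    (i : ι) (g : G i) :
    ∃ γ : Quiver.Path (ctrS N (QuotientGroup.mk 1)) (ctrS N (QuotientGroup.mk (p * of i g))),
      fval N (homMk γ) = PushoutI.base φ (baseDefect N (p * of i g)) * (p * of i g)⁻¹ * K := by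
  obtain ⟨γ, hγ⟩ := hp
  have h2 : armOf N i (QuotientGroup.mk (p * of i g)) = armOf N i (QuotientGroup.mk p) := by
    rw [armOf_mk, armOf_mk, QuotientGroup.eq]
    refine Subgroup.mem_sup_right ⟨g⁻¹, ?_⟩
    rw [map_inv]; group
  refine ⟨(γ.cons (fwd N i (QuotientGroup.mk p) _ rfl)).cons (bwd N i (QuotientGroup.mk (p * of i g)) _ h2),
    ?_⟩
  rw [fval_cons_fwd_cons_bwd γ rfl h2, hγ]
  -- identify the combined label with `β(pg) g⁻¹ β(p)⁻¹`
  have key : (label N i (QuotientGroup.mk (p * of i g)))⁻¹ * label N i (QuotientGroup.mk p) =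
      φ i (baseDefect N (p * of i g)) * g⁻¹ * (φ i (baseDefect N p))⁻¹ := by
    refine eq_of_mul_inv_of_mem hN (out_inv_mul_out_mul_inv_mem (N := N) h2.symm) ?_
    have hm₁ := baseDefect_spec (N := N) p
    have hm₂ := baseDefect_spec (N := N) (p * of i g)
    have := N.mul_mem hm₂ (‹N.Normal›.conj_mem _ (N.inv_mem hm₁)
      (PushoutI.base φ (baseDefect N (p * of i g)) * (of i g)⁻¹ * (PushoutI.base φ (baseDefect N p))⁻¹))
    convert this using 1
    simp only [map_mul, map_inv, of_apply_eq_base]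
    group
  rw [key]
  simp only [map_mul, map_inv, of_apply_eq_base]
  group

/-- A zigzag from `[1]` to every central vertex `[p]` with value `β(p) p⁻¹ β(1)⁻¹` (induction over the
amalgam, `Monoid.PushoutI.induction_on`); in particular `N \ T` is connected. [cite: SerreTrees1980, I §3.3 Thm. 4] -/
theorem exists_path [N.Normal] [Nonempty ι]
    (hN : ∀ (i : ι) (g : G i), (of i g : PushoutI φ) ∈ N → g = 1) (p : PushoutI φ) :
    ∃ γ : Quiver.Path (ctrS N (QuotientGroup.mk 1)) (ctrS N (QuotientGroup.mk p)),
      fval N (homMk γ) = PushoutI.base φ (baseDefect N p) * p⁻¹ *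
        (PushoutI.base φ (baseDefect N 1))⁻¹ := by
  set K := (PushoutI.base φ (baseDefect N (1 : PushoutI φ)))⁻¹
  suffices hstep : ∀ q p : PushoutI φ,
      (∃ γ : Quiver.Path (ctrS N (QuotientGroup.mk 1)) (ctrS N (QuotientGroup.mk p)),
        fval N (homMk γ) = PushoutI.base φ (baseDefect N p) * p⁻¹ * K) →
      ∃ γ : Quiver.Path (ctrS N (QuotientGroup.mk 1)) (ctrS N (QuotientGroup.mk (p * q))),
        fval N (homMk γ) = PushoutI.base φ (baseDefect N (p * q)) * (p * q)⁻¹ * K by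
    have h1 : ∃ γ : Quiver.Path (ctrS N (QuotientGroup.mk 1)) (ctrS N (QuotientGroup.mk 1)),
        fval N (homMk γ) = PushoutI.base φ (baseDefect N 1) * 1⁻¹ * K :=
      ⟨Quiver.Path.nil, by rw [fval_nil, inv_one, mul_one, mul_inv_cancel]⟩
    have := hstep p 1 h1
    rwa [one_mul] at this
  intro q
  induction q using PushoutI.induction_on with
  | of i g => exact fun p hp => exists_path_step hN K hp i g
  | base h =>
    obtain ⟨i⟩ := ‹Nonempty ι›
    intro p hp
    have := exists_path_step hN K hp i (φ i h)
    rwa [of_apply_eq_base] at this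
  | mul x y ihx ihy =>
    intro p hp
    have := ihy (p * x) (ihx p hp)
    rwa [mul_assoc] at this

/-- **(C3) Surjectivity**: every element of `N` is the value of a loop at `[1]`. [cite: SerreTrees1980, I §3.3 Thm. 4] -/
theorem exists_loop_fval_eq [N.Normal] [Nonempty ι] (hφ : ∀ i, Injective (φ i))
    (hN : ∀ (i : ι) (g : G i), (of i g : PushoutI φ) ∈ N → g = 1) {n : PushoutI φ} (hn : n ∈ N) :
    ∃ x : End (obj (ctrS N (QuotientGroup.mk 1))), fval N x = n := by
  have hpN : (PushoutI.base φ (baseDefect N 1))⁻¹ * n⁻¹ * PushoutI.base φ (baseDefect N 1) ∈ N := by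
    have := ‹N.Normal›.conj_mem _ (N.inv_mem hn) (PushoutI.base φ (baseDefect N 1))⁻¹
    simpa using this
  have h1 : (QuotientGroup.mk ((PushoutI.base φ (baseDefect N 1))⁻¹ * n⁻¹ *
      PushoutI.base φ (baseDefect N 1)) : CenterClass N) = QuotientGroup.mk 1 := by
    rw [QuotientGroup.eq, mul_one]
    exact Subgroup.mem_sup_left (N.inv_mem hpN)
  obtain ⟨γ, hγ⟩ := exists_path hN
    ((PushoutI.base φ (baseDefect N 1))⁻¹ * n⁻¹ * PushoutI.base φ (baseDefect N 1))
  rw [baseDefect_eq_of_mem hφ hN hpN] at hγ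
  revert γ
  rw [h1]
  intro γ hγ
  refine ⟨homMk γ, ?_⟩
  rw [hγ]
  group

/-! ### (C4) The vertex group is free and isomorphic to `N` -/

/-- `loopHom` is injective. [cite: SerreTrees1980, I §3.3 Thm. 4] -/
theorem loopHom_injective [N.Normal] (hφ : ∀ i, Injective (φ i)) (c₀ : CenterClass N) :
    Injective (loopHom N c₀) :=
  (injective_iff_map_eq_one _).mpr fun x hx => eq_one_of_fval_eq_one hφ c₀ x hx

/-- The image of `loopHom` at `[1]` is exactly `N`: **`N ≅ π₁(N \ T, [1])`**. [cite: SerreTrees1980, I §3.3 Thm. 4] -/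
theorem range_loopHom [N.Normal] [Nonempty ι] (hφ : ∀ i, Injective (φ i))
    (hN : ∀ (i : ι) (g : G i), (of i g : PushoutI φ) ∈ N → g = 1) :
    (loopHom N (QuotientGroup.mk 1)).range = N := by
  ext n
  constructor
  · rintro ⟨x, rfl⟩
    exact fval_loop_mem x
  · intro hn
    obtain ⟨x, hx⟩ := exists_loop_fval_eq hφ hN hn
    exact ⟨x, hx⟩

/-- The vertex groups of the free groupoid on `N \ T` are free: they embed into the free group on all
arrows by the faithful word functor (Stallings Prop. 5.2, tree file `FreeGroupoidWords`), and subgroups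
of free groups are free (Nielsen–Schreier). [cite: Stallings1983, Prop. 5.2 p.557] -/
theorem isFreeGroup_end (X : Quiver.Symmetrify (quotQuiv N)) : IsFreeGroup (End (obj X)) := by
  let W := wordFunctor (quotQuiv N)
  let w : End (obj X) → FreeGroup (Letter (quotQuiv N)) := fun x => W.map x
  have hone : w (𝟙 (obj X)) = 1 := (W.map_id _).trans (SingleObj.id_as_one _ _)
  have hmul : ∀ x y : End (obj X), w (x ≫ y) = w y * w x := fun x y =>
    (W.map_comp x y).trans (SingleObj.comp_as_mul _ _ _)
  have hinj : Function.Injective w := fun x y hxy =>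
    wordFunctor_map_injective (V := quotQuiv N) (X := X) (Y := X) hxy
  let f : End (obj X) →* FreeGroup (Letter (quotQuiv N)) :=
    { toFun := w
      map_one' := hone
      map_mul' := fun x y => by change w (y ≫ x) = w x * w y; rw [hmul] }
  have hf : Function.Injective f := hinj
  exact IsFreeGroup.ofMulEquiv (MonoidHom.ofInjective hf).symm

end PushoutITree

/-! ### Main theorems -/

open Monoid Monoid.PushoutI Function in
/-- **A normal subgroup of an amalgam meeting the factors trivially is free** (H. Neumann; Serre,
*Trees* I §3.3 Thm. 4 applied to the Bass–Serre tree `T` of I §4.1 Thm. 7, on which such `N` acts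
freely): for `P = ∗_H G_i` (`φ i : H →* G i` injective, at least one factor) and `N ⊴ P` with
`N ∩ G_i = 1` for all `i`, `N ≅ π₁(N \ T, [1])` is a free group.  No finiteness is assumed.
[cite: SerreTrees1980, I §3.3 Thm. 4] -/
theorem PushoutI.isFreeGroup_of_normal_of_of_mem_eq_one {ι : Type u} {G : ι → Type v}
    [∀ i, Group (G i)] {H : Type w} [Group H] {φ : ∀ i, H →* G i} [Nonempty ι]
    (hφ : ∀ i, Injective (φ i)) (N : Subgroup (PushoutI φ)) [N.Normal]
    (hN : ∀ (i : ι) (g : G i), (of i g : PushoutI φ) ∈ N → g = 1) : IsFreeGroup N := by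
  haveI := PushoutITree.isFreeGroup_end (N := N) (PushoutITree.ctrS N (QuotientGroup.mk 1))
  exact IsFreeGroup.ofMulEquiv
    ((MonoidHom.ofInjective (PushoutITree.loopHom_injective (N := N) hφ (QuotientGroup.mk 1))).trans
      (MulEquiv.subgroupCongr (PushoutITree.range_loopHom hφ hN)))

open Monoid Monoid.PushoutI Function in
/-- The same with the hypothesis in conjugation form `∀ i x g, x (of i g) x⁻¹ ∈ N → g = 1` (the shape
produced by `exists_normal_finiteIndex_inf_conj_eq_bot`). [cite: SerreTrees1980, I §3.3 Thm. 4] -/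
theorem PushoutI.isFreeGroup_of_normal_of_conj_of_eq_one {ι : Type u} {G : ι → Type v}
    [∀ i, Group (G i)] {H : Type w} [Group H] {φ : ∀ i, H →* G i} [Nonempty ι]
    (hφ : ∀ i, Injective (φ i)) (N : Subgroup (PushoutI φ)) [N.Normal]
    (hN : ∀ (i : ι) (x : PushoutI φ) (g : G i), x * of i g * x⁻¹ ∈ N → g = 1) : IsFreeGroup N :=
  PushoutI.isFreeGroup_of_normal_of_of_mem_eq_one hφ N fun i g hg => hN i 1 g (by simpa using hg)

end Literature.GroupTheory.CombinatorialGroupTheory
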